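import Summits.NavierStokesRegularity.NavierStokesRegularity.Theorems.TautLoopKelvinCirculationFloorKernelFactorisation
import Summits.NavierStokesRegularity.NavierStokesRegularity.Theorems.TautLoopKelvinCirculationFloorConvolutionTransfer
import Literature.Analysis.FluidPDE.LocalBiotSavartCalculus
import Literature.Analysis.FluidPDE.WholeSpaceIBP
import Literature.Analysis.FluidPDE.LeiZhang2011Proofs
import HarnessLib

/-!
# The circulation Bernstein inequality at unit scale (stub `stub_coreUnitScale`)

Lead's file of crux `stmt-NavierStokesRegularity-1538` (`TautLoopKelvin.CirculationFloor`, line `birth`),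
proving the registered LOAD-BEARING stub `stub_coreUnitScale`: there are an absolute `C > 0` and a
radius `0 < θ ≤ 1` such that for every smooth divergence-free field `v` on `ℝ³` with bounded derivatives
of all orders, if every ball of radius `θ` carries coordinate vorticity fluxes
`|∫_{B(x,θ)} ⟪curl v, eₘ⟫| ≤ 2θε`, then the unit Littlewood–Paley block obeys `‖(Δ̇₀ v)(x)‖ ≤ C ε`.

Proof (physical space, no tails, no energy): with `θ, L, Mₖ` from `stub_kernelFactorisation`
(`K₀ = -Σₖ∂ₖ∂ₖL`, `∂ₖL(t) = ∫_{B(t,θ)} Mₖ`) and the derivative transfer `stub_convolutionTransfer`,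
`Δ̇₀v(x) = ∫ K₀(t) v(x-t) dt = -Σₖ ∫ L(t) ∂ₖ∂ₖv(x-t) dt = -∫ L(t) Δv(x-t) dt = ∫ L(t) curl ω(x-t) dt`
(`Δv = -curl curl v`, tree `laplacian_eq_neg_curl_curl`, `ω = curl v`)
`= Σₖ eₖ × ∫ L(t) ∂ₖω(x-t) dt = Σₖ eₖ × ∫ ∂ₖL(t) ω(x-t) dt = Σₖ eₖ × ∫ Mₖ(y) Φ(x-y) dy`,
`Φ(z) = ∫_{B(z,θ)} ω` (associativity of convolution, Mathlib `MeasureTheory.convolution_assoc`), and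
`‖Φ(z)‖ ≤ Σₘ |∫_{B(z,θ)} ⟪ω, eₘ⟫| ≤ 6θε`, so `‖Δ̇₀v(x)‖ ≤ 6θ (Σₖ‖Mₖ‖₁) ε`. No definitions are introduced.

## References

* H. Bahouri, J.-Y. Chemin, R. Danchin, *Fourier Analysis and Nonlinear PDE* (2011), Lemma 2.1
  (Bernstein; blocks as convolutions). [BahouriCheminDanchin2011]
* A. Cheskidov, R. Shvydkoy, arXiv:0708.3067, Lemma 3.2 (the dyadic quantity this feeds). [CheskidovShvydkoy2010]
-/

noncomputable section

open MeasureTheory SchwartzMap Real Set Metric Filter Topology Function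
open scoped RealInnerProductSpace LineDeriv ContDiff Convolution Laplacian

-- the summit and its single sub-problem share the name (CONVENTIONS §1), as in every Theorems file
set_option linter.dupNamespace false

namespace Summit.NavierStokesRegularity.NavierStokesRegularity.Theorems.CirculationFloor.Birth

open Literature.Analysis Literature.Analysis.FluidPDE Literature.Analysis.FunctionSpaces

/-! ### Pointwise algebra on `ℝ³` -/

/-- **`curl w = Σₖ eₖ × ∂ₖ w`** (coordinates). [folklore] -/
theorem core_curl_eq_sum_cross (w : EuclideanSpace ℝ (Fin 3) → EuclideanSpace ℝ (Fin 3))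
    (y : EuclideanSpace ℝ (Fin 3)) :
    curl w y = ∑ k : Fin 3, cross (EuclideanSpace.single k (1 : ℝ))
      (fderiv ℝ w y (EuclideanSpace.single k (1 : ℝ))) := by
  ext i
  fin_cases i <;>
    simp [curl, cross, cross_apply, Fin.sum_univ_three] <;> ring

/-- `‖w‖ ≤ Σₘ |⟪w, eₘ⟫|` on `ℝ³`. [folklore] -/
theorem core_norm_le_sum_abs_inner (w : EuclideanSpace ℝ (Fin 3)) :
    ‖w‖ ≤ ∑ m : Fin 3, |⟪w, EuclideanSpace.single m (1 : ℝ)⟫| := by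
  have hcoord : ∀ m : Fin 3, ⟪w, EuclideanSpace.single m (1 : ℝ)⟫ = w m := fun m => by
    rw [EuclideanSpace.inner_single_right]; simp
  simp only [hcoord, Fin.sum_univ_three]
  have hsq : ‖w‖ ^ 2 = w 0 ^ 2 + w 1 ^ 2 + w 2 ^ 2 := by
    rw [EuclideanSpace.real_norm_sq_eq, Fin.sum_univ_three]
  have h0 := abs_nonneg (w 0)
  have h1 := abs_nonneg (w 1)
  have h2 := abs_nonneg (w 2)
  have hle : ‖w‖ ^ 2 ≤ (|w 0| + |w 1| + |w 2|) ^ 2 := by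
    rw [hsq, ← sq_abs (w 0), ← sq_abs (w 1), ← sq_abs (w 2)]
    nlinarith
  exact (pow_le_pow_iff_left₀ (norm_nonneg w) (by positivity) two_ne_zero).1 hle

/-- The Laplacian as the sum of second coordinate derivatives (standard basis of `ℝ³`). [folklore] -/
theorem core_laplacian_eq_sum {v : EuclideanSpace ℝ (Fin 3) → EuclideanSpace ℝ (Fin 3)}
    (hv : ContDiff ℝ 2 v) (y : EuclideanSpace ℝ (Fin 3)) :
    (Δ v) y = ∑ k : Fin 3, fderiv ℝ (fun z => fderiv ℝ v z (EuclideanSpace.single k (1 : ℝ))) y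
      (EuclideanSpace.single k (1 : ℝ)) := by
  rw [laplacian_eq_sum_fderiv_fderiv (EuclideanSpace.basisFun (Fin 3) ℝ) hv]
  simp only [EuclideanSpace.basisFun_apply]

/-! ### Convolutions with the ball indicator -/

/-- `(M ⋆ 𝟙_{B(0,θ)})(t) = ∫_{B(t,θ)} M`. [folklore] -/
theorem core_conv_indicator_right (Mk : EuclideanSpace ℝ (Fin 3) → ℝ) (θ : ℝ) (t : EuclideanSpace ℝ (Fin 3)) :
    (Mk ⋆[ContinuousLinearMap.lsmul ℝ ℝ, volume]
      ((ball (0 : EuclideanSpace ℝ (Fin 3)) θ).indicator fun _ => (1 : ℝ))) t = ∫ s in ball t θ, Mk s := by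
  rw [convolution_lsmul, ← integral_indicator measurableSet_ball]
  refine integral_congr_ae (Eventually.of_forall fun s => ?_)
  show Mk s • (ball (0 : EuclideanSpace ℝ (Fin 3)) θ).indicator (fun _ => (1 : ℝ)) (t - s) =
    (ball t θ).indicator Mk s
  by_cases hs : s ∈ ball t θ
  · have hts : t - s ∈ ball (0 : EuclideanSpace ℝ (Fin 3)) θ := by
      rwa [mem_ball_zero_iff, ← dist_eq_norm, dist_comm]
    rw [indicator_of_mem hts, indicator_of_mem hs, smul_eq_mul, mul_one]
  · have hts : t - s ∉ ball (0 : EuclideanSpace ℝ (Fin 3)) θ := by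
      rwa [mem_ball_zero_iff, ← dist_eq_norm, dist_comm]
    rw [indicator_of_notMem hts, indicator_of_notMem hs, smul_zero]

/-- `(𝟙_{B(0,θ)} ⋆ g)(z) = ∫_{B(z,θ)} g` for a vector field `g`. [folklore] -/
theorem core_conv_indicator_left (g : EuclideanSpace ℝ (Fin 3) → EuclideanSpace ℝ (Fin 3)) (θ : ℝ)
    (z : EuclideanSpace ℝ (Fin 3)) :
    (((ball (0 : EuclideanSpace ℝ (Fin 3)) θ).indicator fun _ => (1 : ℝ)) ⋆[ContinuousLinearMap.lsmul ℝ ℝ,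
      volume] g) z = ∫ s in ball z θ, g s := by
  rw [convolution_lsmul, ← integral_indicator measurableSet_ball,
    ← integral_sub_left_eq_self (fun y => (ball z θ).indicator g y) volume z]
  refine integral_congr_ae (Eventually.of_forall fun t => ?_)
  show (ball (0 : EuclideanSpace ℝ (Fin 3)) θ).indicator (fun _ => (1 : ℝ)) t • g (z - t) =
    (ball z θ).indicator g (z - t)
  by_cases ht : t ∈ ball (0 : EuclideanSpace ℝ (Fin 3)) θ
  · have hzt : z - t ∈ ball z θ := by
      rw [mem_ball_zero_iff] at ht
      rwa [mem_ball, dist_eq_norm, sub_sub_cancel_left, norm_neg]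
    rw [indicator_of_mem ht, indicator_of_mem hzt, one_smul]
  · have hzt : z - t ∉ ball z θ := by
      rw [mem_ball_zero_iff] at ht
      rwa [mem_ball, dist_eq_norm, sub_sub_cancel_left, norm_neg]
    rw [indicator_of_notMem ht, indicator_of_notMem hzt, zero_smul]

/-- The vector ball integral is controlled by the coordinate fluxes: if every
`|∫_{B(z,θ)} ⟪g, eₘ⟫| ≤ 2θε` then `‖∫_{B(z,θ)} g‖ ≤ 6θε`. [folklore] -/
theorem core_norm_setIntegral_le {g : EuclideanSpace ℝ (Fin 3) → EuclideanSpace ℝ (Fin 3)} {θ ε : ℝ}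
    (hflux : ∀ (z : EuclideanSpace ℝ (Fin 3)) (m : Fin 3),
      |∫ y in ball z θ, ⟪g y, EuclideanSpace.single m (1 : ℝ)⟫| ≤ 2 * θ * ε)
    {z : EuclideanSpace ℝ (Fin 3)} (hint : IntegrableOn g (ball z θ) volume) :
    ‖∫ y in ball z θ, g y‖ ≤ 6 * θ * ε := by
  refine (core_norm_le_sum_abs_inner _).trans ?_
  calc ∑ m : Fin 3, |⟪∫ y in ball z θ, g y, EuclideanSpace.single m (1 : ℝ)⟫|
      = ∑ m : Fin 3, |∫ y in ball z θ, ⟪g y, EuclideanSpace.single m (1 : ℝ)⟫| :=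
        Finset.sum_congr rfl fun m _ => by
          rw [real_inner_comm, ← integral_inner hint]
          congr 1
          exact integral_congr_ae (Eventually.of_forall fun y => real_inner_comm _ _)
    _ ≤ ∑ _m : Fin 3, 2 * θ * ε := Finset.sum_le_sum fun m _ => hflux z m
    _ = 6 * θ * ε := by simp; ring

/-! ### The registered stub -/

/-- **Registered stub `stub_coreUnitScale` — the circulation Bernstein inequality at unit scale**
(crux `stmt-NavierStokesRegularity-1538`, line `birth`, LOAD-BEARING): there are an absolute `C > 0`
and a radius `0 < θ ≤ 1` such that for every smooth divergence-free field `v` on `ℝ³` with bounded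
derivatives of all orders and every `ε ≥ 0`, if every ball of radius `θ` carries coordinate vorticity
fluxes `|∫_{B(x,θ)} ⟪curl v, eₘ⟫| ≤ 2θε`, then `‖(Δ̇₀ v)(x)‖ ≤ C ε` for all `x`. See the module
docstring for the chain of identities. [folklore] -/
theorem stub_coreUnitScale :
    ∃ C θ : ℝ, 0 < C ∧ 0 < θ ∧ θ ≤ 1 ∧
      ∀ (v : EuclideanSpace ℝ (Fin 3) → EuclideanSpace ℝ (Fin 3)), ContDiff ℝ (⊤ : ℕ∞) v →
        (∀ n : ℕ, ∃ B : ℝ, ∀ x, ‖iteratedFDeriv ℝ n v x‖ ≤ B) →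
        Literature.Analysis.FluidPDE.VectorCalculus.IsDivFree v →
        ∀ ε : ℝ, 0 ≤ ε →
          (∀ (x : EuclideanSpace ℝ (Fin 3)) (m : Fin 3),
            |∫ y in Metric.ball x θ, inner ℝ (Literature.Analysis.FluidPDE.curl v y)
              (EuclideanSpace.single m (1 : ℝ))| ≤ 2 * θ * ε) →
          ∀ x : EuclideanSpace ℝ (Fin 3), ‖Literature.Analysis.FunctionSpaces.blockFn 0 v x‖ ≤ C * ε := by
  obtain ⟨θ, hθ, hθ1, L, M, hK, hM⟩ := stub_kernelFactorisation
  -- the constant: `6θ (Σₖ ‖Mₖ‖₁ + 1)`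
  set A : ℝ := ∑ k : Fin 3, ∫ y, ‖M k y‖ with hA
  have hA0 : 0 ≤ A := Finset.sum_nonneg fun k _ => integral_nonneg fun y => norm_nonneg _
  refine ⟨6 * θ * (A + 1), θ, by positivity, hθ, hθ1, ?_⟩
  intro v hv hbd hdiv ε hε hflux x
  /- regularity of `v`, `∂ₖv`, `ω = curl v` -/
  obtain ⟨B₀, hB₀⟩ := hbd 0
  obtain ⟨B₁, hB₁⟩ := hbd 1
  obtain ⟨B₂, hB₂⟩ := hbd 2
  have hv1 : ContDiff ℝ 1 v := contDiff_infty.1 hv 1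
  have hv2 : ContDiff ℝ 2 v := contDiff_infty.1 hv 2
  have hdiff : Differentiable ℝ v := hv1.differentiable one_ne_zero
  have hDv : ContDiff ℝ 1 (fderiv ℝ v) := hv2.fderiv_right (m := 1) le_rfl
  have hbv : ∀ y, ‖v y‖ ≤ B₀ := fun y => by simpa using hB₀ y
  have hbDv : ∀ y, ‖fderiv ℝ v y‖ ≤ B₁ := fun y => by
    have h := hB₁ y
    rwa [← norm_iteratedFDeriv_fderiv, norm_iteratedFDeriv_zero] at h
  have hbD2v : ∀ y, ‖fderiv ℝ (fderiv ℝ v) y‖ ≤ B₂ := fun y => by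
    have h := hB₂ y
    rwa [← norm_iteratedFDeriv_fderiv, ← norm_iteratedFDeriv_fderiv, norm_iteratedFDeriv_zero] at h
  -- `∂ₖ v`
  have hdk : ∀ k : Fin 3, ContDiff ℝ 1 (fun y => fderiv ℝ v y (EuclideanSpace.single k (1 : ℝ))) :=
    fun k => hDv.clm_apply contDiff_const
  have hbdk : ∀ (k : Fin 3) (y), ‖fderiv ℝ v y (EuclideanSpace.single k (1 : ℝ))‖ ≤ B₁ := fun k y =>
    (ContinuousLinearMap.le_opNorm _ _).trans (by simp [hbDv y])
  have hbDdk : ∀ (k : Fin 3) (y),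
      ‖fderiv ℝ (fun y => fderiv ℝ v y (EuclideanSpace.single k (1 : ℝ))) y‖ ≤ B₂ := by
    intro k y
    have hd : DifferentiableAt ℝ (fderiv ℝ v) y := (hDv.differentiable one_ne_zero) y
    rw [fderiv_clm_apply hd (differentiableAt_const _), fderiv_fun_const, Pi.zero_apply,
      ContinuousLinearMap.comp_zero, zero_add]
    refine (ContinuousLinearMap.le_opNorm _ _).trans ?_
    rw [ContinuousLinearMap.opNorm_flip, show ‖EuclideanSpace.single k (1 : ℝ)‖ = 1 by simp, mul_one]
    exact hbD2v y
  -- `ω = curl v`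
  have hω1 : ContDiff ℝ 1 (curl v) := by
    rw [curl_eq_curlCLM_comp]
    exact curlCLM.contDiff.comp hDv
  have hωc : Continuous (curl v) := hω1.continuous
  have hbω : ∀ y, ‖curl v y‖ ≤ ‖curlCLM‖ * B₁ := fun y => by
    rw [curl_eq_curlCLM]
    exact (curlCLM.le_opNorm _).trans (mul_le_mul_of_nonneg_left (hbDv y) (norm_nonneg _))
  have hbDω : ∀ y, ‖fderiv ℝ (curl v) y‖ ≤ ‖curlCLM‖ * B₂ := fun y => by
    have h : HasFDerivAt (curl v) (curlCLM.comp (fderiv ℝ (fderiv ℝ v) y)) y := by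
      rw [curl_eq_curlCLM_comp]
      exact curlCLM.hasFDerivAt.comp y ((hDv.differentiable one_ne_zero) y).hasFDerivAt
    rw [h.fderiv]
    exact (ContinuousLinearMap.opNorm_comp_le _ _).trans (mul_le_mul_of_nonneg_left (hbD2v y) (norm_nonneg _))
  /- Step 1: expand the kernel, `Δ̇₀v(x) = -Σₖ ∫ ∂ₖ∂ₖL(t) v(x-t) dt` -/
  have hD2L : ∀ k : Fin 3, (fun t => fderiv ℝ (fun y => fderiv ℝ (fun z => L z) y
      (EuclideanSpace.single k (1 : ℝ))) t (EuclideanSpace.single k (1 : ℝ))) =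
      ⇑((∂_{EuclideanSpace.single k (1 : ℝ)} ((∂_{EuclideanSpace.single k (1 : ℝ)} L :
        𝓢(EuclideanSpace ℝ (Fin 3), ℝ))) : 𝓢(EuclideanSpace ℝ (Fin 3), ℝ))) := fun k => rfl
  have hint1 : ∀ k : Fin 3, Integrable (fun t => fderiv ℝ (fun y => fderiv ℝ (fun z => L z) y
      (EuclideanSpace.single k (1 : ℝ))) t (EuclideanSpace.single k (1 : ℝ)) • v (x - t)) := fun k =>
    transfer_integrable_smul_of_bdd (φ := fun t => fderiv ℝ (fun y => fderiv ℝ (fun z => L z) y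
      (EuclideanSpace.single k (1 : ℝ))) t (EuclideanSpace.single k (1 : ℝ)))
      (by rw [hD2L k]; exact SchwartzMap.integrable _)
      (hv.continuous.comp (continuous_const.sub continuous_id)) B₀ fun t => hbv _
  have step1 : blockFn 0 v x = -∑ k : Fin 3, ∫ t, fderiv ℝ (fun y => fderiv ℝ (fun z => L z) y
      (EuclideanSpace.single k (1 : ℝ))) t (EuclideanSpace.single k (1 : ℝ)) • v (x - t) := by
    rw [blockFn_apply, ← integral_finsetSum _ fun k _ => hint1 k, ← integral_neg]
    refine integral_congr_ae (Eventually.of_forall fun t => ?_)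
    simp only [hK t, neg_smul, Finset.sum_smul]
  /- Steps 2–3: two derivative transfers, `∫ ∂ₖ∂ₖL v(x-·) = ∫ L ∂ₖ∂ₖv(x-·)` -/
  have step23 : ∀ k : Fin 3, ∫ t, fderiv ℝ (fun y => fderiv ℝ (fun z => L z) y
      (EuclideanSpace.single k (1 : ℝ))) t (EuclideanSpace.single k (1 : ℝ)) • v (x - t) =
      ∫ t, L t • fderiv ℝ (fun y => fderiv ℝ v y (EuclideanSpace.single k (1 : ℝ))) (x - t)
        (EuclideanSpace.single k (1 : ℝ)) := by
    intro k
    have h2 := stub_convolutionTransfer ((∂_{EuclideanSpace.single k (1 : ℝ)} L :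
      𝓢(EuclideanSpace ℝ (Fin 3), ℝ))) v (EuclideanSpace.single k (1 : ℝ)) B₀ B₁ hv1 hbv hbDv x
    have h3 := stub_convolutionTransfer L (fun y => fderiv ℝ v y (EuclideanSpace.single k (1 : ℝ)))
      (EuclideanSpace.single k (1 : ℝ)) B₁ B₂ (hdk k) (hbdk k) (hbDdk k) x
    exact h2.trans h3
  /- Step 4: sum = `-∫ L Δv(x-·) = ∫ L curl ω (x-·)` -/
  have hintL : ∀ k : Fin 3, Integrable (fun t => L t • fderiv ℝ (fun y => fderiv ℝ v y
      (EuclideanSpace.single k (1 : ℝ))) (x - t) (EuclideanSpace.single k (1 : ℝ))) := fun k =>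
    transfer_integrable_smul_of_bdd L.integrable ((((hdk k).continuous_fderiv one_ne_zero).clm_apply
      continuous_const).comp (continuous_const.sub continuous_id)) B₂ fun t =>
        (ContinuousLinearMap.le_opNorm _ _).trans (by simpa using hbDdk k (x - t))
  have step4 : blockFn 0 v x = ∫ t, L t • curl (curl v) (x - t) := by
    rw [step1, Finset.sum_congr rfl fun k _ => step23 k, ← integral_finsetSum _ fun k _ => hintL k,
      ← integral_neg]
    refine integral_congr_ae (Eventually.of_forall fun t => ?_)
    dsimp only
    rw [← Finset.smul_sum, ← core_laplacian_eq_sum hv2, laplacian_eq_neg_curl_curl hv2 hdiv, smul_neg,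
      neg_neg]
  /- Step 5: `curl ω = Σₖ eₖ × ∂ₖω`, pull `eₖ ×` out of the integral -/
  have hintω : ∀ k : Fin 3, Integrable (fun t => L t • fderiv ℝ (curl v) (x - t)
      (EuclideanSpace.single k (1 : ℝ))) := fun k =>
    transfer_integrable_smul_of_bdd L.integrable (((hω1.continuous_fderiv one_ne_zero).clm_apply
      continuous_const).comp (continuous_const.sub continuous_id)) (‖curlCLM‖ * B₂) fun t =>
        (ContinuousLinearMap.le_opNorm _ _).trans (by simpa using hbDω (x - t))
  have step5 : blockFn 0 v x = ∑ k : Fin 3, crossCLM (EuclideanSpace.single k (1 : ℝ))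
      (∫ t, L t • fderiv ℝ (curl v) (x - t) (EuclideanSpace.single k (1 : ℝ))) := by
    rw [step4]
    simp_rw [core_curl_eq_sum_cross (curl v), Finset.smul_sum]
    rw [integral_finsetSum _ fun k _ => ?_]
    · refine Finset.sum_congr rfl fun k _ => ?_
      rw [← (crossCLM (EuclideanSpace.single k (1 : ℝ))).integral_comp_comm (hintω k)]
      refine integral_congr_ae (Eventually.of_forall fun t => ?_)
      simp only [crossCLM_apply, map_smul]
    · have h := (crossCLM (EuclideanSpace.single k (1 : ℝ))).integrable_comp (hintω k)
      refine h.congr (Eventually.of_forall fun t => ?_)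
      simp only [crossCLM_apply, map_smul]
  /- Step 6: transfer back, `∫ L ∂ₖω(x-·) = ∫ ∂ₖL ω(x-·)` -/
  have step6 : ∀ k : Fin 3, ∫ t, L t • fderiv ℝ (curl v) (x - t) (EuclideanSpace.single k (1 : ℝ)) =
      ∫ t, fderiv ℝ (fun z => L z) t (EuclideanSpace.single k (1 : ℝ)) • curl v (x - t) := fun k =>
    (stub_convolutionTransfer L (curl v) (EuclideanSpace.single k (1 : ℝ)) _ _ hω1 hbω hbDω x).symm
  /- Step 7: `∂ₖL = Mₖ ⋆ 𝟙_B`, associativity: `∫ ∂ₖL ω(x-·) = ∫ Mₖ(y) Φ(x-y) dy` -/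
  obtain ⟨χ, hχ⟩ : ∃ χ : EuclideanSpace ℝ (Fin 3) → ℝ,
      χ = (ball (0 : EuclideanSpace ℝ (Fin 3)) θ).indicator fun _ => (1 : ℝ) := ⟨_, rfl⟩
  have hχint : Integrable χ := by
    rw [hχ, integrable_indicator_iff measurableSet_ball]
    exact integrableOn_const measure_ball_lt_top.ne
  have hDLconv : ∀ k : Fin 3, (fun t => fderiv ℝ (fun z => L z) t (EuclideanSpace.single k (1 : ℝ))) =
      (⇑(M k)) ⋆[ContinuousLinearMap.lsmul ℝ ℝ, volume] χ := fun k => by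
    funext t
    rw [hM k t, hχ, core_conv_indicator_right]
  have step7 : ∀ k : Fin 3, ∫ t, fderiv ℝ (fun z => L z) t (EuclideanSpace.single k (1 : ℝ)) • curl v (x - t) =
      ∫ y, M k y • ∫ s in ball (x - y) θ, curl v s := by
    intro k
    have hassoc := convolution_assoc (ContinuousLinearMap.lsmul ℝ ℝ) (ContinuousLinearMap.lsmul ℝ ℝ)
      (ContinuousLinearMap.lsmul ℝ ℝ) (ContinuousLinearMap.lsmul ℝ ℝ)
      (fun (a b : ℝ) (z : EuclideanSpace ℝ (Fin 3)) => by
        simp only [ContinuousLinearMap.lsmul_apply, smul_eq_mul, mul_smul])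
      (x₀ := x) (f := ⇑(M k)) (g := χ) (k := curl v) (μ := volume) (ν := volume)
      (M k).continuous.aestronglyMeasurable hχint.aestronglyMeasurable hωc.aestronglyMeasurable
      ?_ ?_ ?_
    · rw [← convolution_lsmul, hDLconv k, hassoc, convolution_lsmul]
      refine integral_congr_ae (Eventually.of_forall fun y => ?_)
      show M k y • (χ ⋆[ContinuousLinearMap.lsmul ℝ ℝ, volume] curl v) (x - y) =
        M k y • ∫ s in ball (x - y) θ, curl v s
      rw [hχ, core_conv_indicator_left]
    · -- `Mₖ ⋆ χ` exists everywhere: the integrand is `𝟙_{B(y,θ)} Mₖ`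
      refine Eventually.of_forall fun y => ?_
      have heq : (fun s => (ContinuousLinearMap.lsmul ℝ ℝ) (M k s) (χ (y - s))) = (ball y θ).indicator ⇑(M k) := by
        funext s
        rw [ContinuousLinearMap.lsmul_apply]
        by_cases hs : s ∈ ball y θ
        · have hys : y - s ∈ ball (0 : EuclideanSpace ℝ (Fin 3)) θ := by
            rwa [mem_ball_zero_iff, ← dist_eq_norm, dist_comm]
          rw [hχ, indicator_of_mem hs, indicator_of_mem hys, smul_eq_mul, mul_one]
        · have hys : y - s ∉ ball (0 : EuclideanSpace ℝ (Fin 3)) θ := by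
            rwa [mem_ball_zero_iff, ← dist_eq_norm, dist_comm]
          rw [hχ, indicator_of_notMem hs, indicator_of_notMem hys, smul_zero]
      show Integrable _ _
      rw [heq]
      exact (M k).integrable.indicator measurableSet_ball
    · -- `‖χ‖ ⋆ ‖ω‖` exists everywhere
      refine Eventually.of_forall fun z => ?_
      show Integrable _ _
      have heq : (fun s => (ContinuousLinearMap.mul ℝ ℝ) ‖χ s‖ ‖curl v (z - s)‖) =
          (ball (0 : EuclideanSpace ℝ (Fin 3)) θ).indicator fun s => ‖curl v (z - s)‖ := by
        funext s
        rw [ContinuousLinearMap.mul_apply']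
        by_cases hs : s ∈ ball (0 : EuclideanSpace ℝ (Fin 3)) θ
        · rw [hχ, indicator_of_mem hs, indicator_of_mem hs, norm_one, one_mul]
        · rw [hχ, indicator_of_notMem hs, indicator_of_notMem hs, norm_zero, zero_mul]
      rw [heq]
      exact (((hωc.comp (continuous_const.sub continuous_id)).norm).continuousOn.integrableOn_compact
        (isCompact_closedBall 0 θ)).mono_set ball_subset_closedBall |>.integrable_indicator
          measurableSet_ball
    · -- `‖Mₖ‖ ⋆ (‖χ‖ ⋆ ‖ω‖)` exists at `x`: integrable times bounded continuous
      show Integrable _ _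
      have hbχ : BddAbove (range fun s => ‖(fun s => ‖curl v s‖) s‖) :=
        ⟨‖curlCLM‖ * B₁, by rintro _ ⟨s, rfl⟩; simpa using hbω s⟩
      have hHc : Continuous ((fun s => ‖χ s‖) ⋆[ContinuousLinearMap.mul ℝ ℝ, volume] fun s => ‖curl v s‖) :=
        hbχ.continuous_convolution_right_of_integrable _ hχint.norm hωc.norm
      have hHb : ∀ z, ‖((fun s => ‖χ s‖) ⋆[ContinuousLinearMap.mul ℝ ℝ, volume] fun s => ‖curl v s‖) z‖ ≤
          (∫ s, ‖χ s‖) * (‖curlCLM‖ * B₁) := by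
        intro z
        rw [convolution_def]
        refine (norm_integral_le_of_norm_le (hχint.norm.mul_const _)
          (Eventually.of_forall fun s => ?_)).trans (le_of_eq (integral_mul_const _ _))
        rw [ContinuousLinearMap.mul_apply', norm_mul, norm_norm, norm_norm]
        exact mul_le_mul_of_nonneg_left (hbω _) (norm_nonneg _)
      have h := ((M k).integrable (μ := volume)).norm.smul_bdd ((∫ s, ‖χ s‖) * (‖curlCLM‖ * B₁))
        ((hHc.comp (continuous_const.sub continuous_id)).aestronglyMeasurable)
        (Eventually.of_forall fun s => hHb (x - s))
      refine h.congr (Eventually.of_forall fun s => ?_)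
      simp only [Pi.smul_apply', smul_eq_mul, ContinuousLinearMap.mul_apply', Function.comp_apply,
        Pi.sub_apply, id_eq]
  /- Step 8: the estimate -/
  have hΦ : ∀ z, ‖∫ s in ball z θ, curl v s‖ ≤ 6 * θ * ε := fun z =>
    core_norm_setIntegral_le hflux ((hωc.continuousOn.integrableOn_compact (isCompact_closedBall z θ)).mono_set
      ball_subset_closedBall)
  have hIk : ∀ k : Fin 3, ‖∫ y, M k y • ∫ s in ball (x - y) θ, curl v s‖ ≤ (∫ y, ‖M k y‖) * (6 * θ * ε) := by
    intro k
    refine (norm_integral_le_of_norm_le ((M k).integrable.norm.mul_const _)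
      (Eventually.of_forall fun y => ?_)).trans (le_of_eq (integral_mul_const _ _))
    rw [norm_smul]
    exact mul_le_mul_of_nonneg_left (hΦ _) (norm_nonneg _)
  rw [step5]
  calc ‖∑ k : Fin 3, crossCLM (EuclideanSpace.single k (1 : ℝ))
        (∫ t, L t • fderiv ℝ (curl v) (x - t) (EuclideanSpace.single k (1 : ℝ)))‖
      ≤ ∑ k : Fin 3, ‖crossCLM (EuclideanSpace.single k (1 : ℝ))
        (∫ t, L t • fderiv ℝ (curl v) (x - t) (EuclideanSpace.single k (1 : ℝ)))‖ := norm_sum_le _ _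
    _ ≤ ∑ k : Fin 3, (∫ y, ‖M k y‖) * (6 * θ * ε) := Finset.sum_le_sum fun k _ => by
        rw [crossCLM_apply, step6 k, step7 k]
        refine (norm_cross_le_norm_mul_norm _ _).trans ?_
        rw [show ‖EuclideanSpace.single k (1 : ℝ)‖ = 1 by simp, one_mul]
        exact hIk k
    _ = A * (6 * θ * ε) := by rw [hA, Finset.sum_mul]
    _ ≤ 6 * θ * (A + 1) * ε := by nlinarith [mul_nonneg hθ.le hε]

end Summit.NavierStokesRegularity.NavierStokesRegularity.Theorems.CirculationFloor.Birth

end
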